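import Literature.AlgebraicGeometry.Frobenioids.PerfFactorialPerfection
import Literature.AlgebraicGeometry.Frobenioids.PerfectionPrimes
import Literature.AlgebraicGeometry.Frobenioids.PerfFactorialPrimes
import Literature.AlgebraicGeometry.Frobenioids.Factorization
import Literature.AnabelianGeometry.EtaleTheta.PerfectionPrimes
import HarnessLib

/-!
# [FrdI] Definition 2.4 (i), clause (d), FAILS for an infinite direct product of copies of `ℤ≥0`:
# the monoid `(ℤ≥0)^ℕ` is NOT perf-factorial — a kernel witness

Mochizuki, *The geometry of Frobenioids I: the general theory*, Kyushu J. Math. **62** (2008), Def. 2.4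
(i), kurims p.47 [cite: MochizukiFrdI2008, Def. 2.4(i) p.47], clause (d): "If `a ∈ M^pf_factor` and
`b ∈ M^pf` satisfy `Supp(a) ⊆ Supp(b)`, then `a ∈ M^pf`" — typed faithfully by the tree as
`IsPerfFactorial.mem_range_of_supp_subset` (`PerfFactorial.lean`).  Here `M^pf` is the perfection of §0
p.11 (`Perfection`), whose elements `a^{1/n}` have BOUNDED denominators.

THIS FILE (theorems only; abc-iut cell finding F-L2d2-1 of seat abc-iut-L2-d2) proves
`not_isPerfFactorial_multiplicative_pi_nat : ¬ IsPerfFactorial (Multiplicative (ℕ → ℕ))`: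
for `M = (ℤ≥0)^ℕ` (written multiplicatively) the primes are the coordinates, `b := (1, 1, 1, …) ∈ M`
has full support, and the element `a := (e_i^{1/(i+2)})_i` of `M^pf_factor = ∏_𝔮 M^pf_𝔮` has
`Supp(a) ⊆ Supp(b)`; clause (d) would give `a = c` for some `c = m^{1/n} ∈ M^pf`, whence (comparing the
`𝔮_n`-components through the factorization homomorphism) `(n + 2) · m_n = n`, absurd.  The proof uses
only clause (d) together with the factorization homomorphism of clause (c) (whose characterising
property is available under the hypothesis being refuted); that (a)–(c) do hold for this `M` is not
verified here.  Content: (d), read with the §0 perfection, forbids elements of infinite support over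
`ℤ`-type primes.

WHY IT MATTERS ([EtTh] Prop 3.2 (i) / 3.4 (i), PDF pp.70/74 [cite: MochizukiEtTh2009, Prop 3.4 p.74]): for
the universal combinatorial covering `Z_∞^log` of the Tate curve (special fibre an INFINITE chain),
`Div⁺(Z_∞^log) ⊇ ∏_j ℤ≥0·(e_j C_j)` and `div(π)` has full support, so `Φ₀(Y)` for such `Y` (and `Φ(A)` at
every `A` over it in a tempered Frobenioid of monoid type `ℤ`/`ℚ` — the `A_⊚` of [EtTh] §5) is not
perf-factorial in the printed sense ("DIV⁺(Z_∞^log)^pf ≅ ∏ ℚ≥0" holds only for the bounded-denominator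
sub-product); what the theory USES from (d) — the order criterion and restriction to sub-supports — does
hold for such `M` (finding F-L2d2-1 of the abc-iut cell proposes the weakening).
HONEST FRAMING: a statement about a classical definition; nothing here bears on [IUTchIII] Cor. 3.12.
-/

namespace Literature.AlgebraicGeometry.Frobenioids

namespace PerfFactorialProductCounterexample

open Function Literature.AnabelianGeometry.EtaleTheta

/-! ### The monoid `M = (ℤ≥0)^ℕ`, multiplicatively, and its coordinate vectors -/

/-- `M := (ℤ≥0)^ℕ` written multiplicatively. [cite: MochizukiFrdI2008, Def. 2.4(i) p.47] -/
abbrev M : Type := Multiplicative (ℕ → ℕ)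

/-- The `i`-th coordinate vector `e_i`, with exponent `k`: `e_i^k`. [cite: MochizukiFrdI2008, §0 p.12] -/
def single (i k : ℕ) : M := Multiplicative.ofAdd (Pi.single i k)

/-- Divisibility in `M` is the pointwise order. [cite: MochizukiFrdI2008, §0 p.12] -/
theorem ofAdd_dvd_iff {f g : ℕ → ℕ} : Multiplicative.ofAdd f ∣ (Multiplicative.ofAdd g : M) ↔ f ≤ g := by
  constructor
  · rintro ⟨h, hh⟩
    have hg : g = f + Multiplicative.toAdd h := by
      have := congrArg Multiplicative.toAdd hh
      simpa using this
    intro j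
    rw [hg]
    exact Nat.le_add_right _ _
  · intro hfg
    refine ⟨Multiplicative.ofAdd (g - f), ?_⟩
    rw [← ofAdd_add]
    congr 1
    funext j
    exact (Nat.add_sub_cancel' (hfg j)).symm

/-- Every element of `M` is `ofAdd` of its exponent function. [folklore] -/
private theorem eq_ofAdd (x : M) : x = Multiplicative.ofAdd (Multiplicative.toAdd x) := rfl

/-- Powers in `M` are pointwise multiples. [folklore] -/
private theorem ofAdd_pow (f : ℕ → ℕ) (n : ℕ) : (Multiplicative.ofAdd f : M) ^ n = Multiplicative.ofAdd (n • f) :=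
  (ofAdd_nsmul n f).symm

/-- `e_i^k · e_i^l = e_i^{k+l}`. [folklore] -/
private theorem single_mul_single (i k l : ℕ) : single i k * single i l = single i (k + l) := by
  rw [single, single, single, ← ofAdd_add, ← Pi.single_add]

/-- `(e_i^k)^n = e_i^{nk}`. [folklore] -/
private theorem single_pow (i k n : ℕ) : single i k ^ n = single i (n * k) := by
  rw [single, ofAdd_pow, single]
  congr 1
  funext j
  by_cases hj : j = i
  · subst hj; simp
  · simp [hj]

/-- `e_i^0 = 1`. [folklore] -/
@[simp] private theorem single_zero (i : ℕ) : single i 0 = 1 := by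
  simp [single]

/-- `e_i^k ≠ 1` for `k ≠ 0`. [folklore] -/
private theorem single_ne_one {i k : ℕ} (hk : k ≠ 0) : single i k ≠ 1 := by
  intro h
  have := congrFun (congrArg Multiplicative.toAdd h) i
  simp [single] at this
  exact hk this

/-- The exponent of `x ∈ M` at `j`. [folklore] -/
abbrev coeff (x : M) (j : ℕ) : ℕ := Multiplicative.toAdd x j

/-- Exponents of a product. [folklore] -/
private theorem coeff_mul (x y : M) (j : ℕ) : coeff (x * y) j = coeff x j + coeff y j := rfl

/-- Exponents of a power. [folklore] -/
private theorem coeff_pow (x : M) (n j : ℕ) : coeff (x ^ n) j = n * coeff x j := by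
  rw [eq_ofAdd x, ofAdd_pow]
  simp [coeff]

/-- Exponents of `e_i^k` at `i`. [folklore] -/
@[simp] private theorem coeff_single_same (i k : ℕ) : coeff (single i k) i = k := by
  simp [coeff, single]

/-- Exponents of `e_i^k` off `i`. [folklore] -/
private theorem coeff_single_of_ne {i j : ℕ} (h : j ≠ i) (k : ℕ) : coeff (single i k) j = 0 := by
  simp [coeff, single, h]

/-- `x ≼ e_i^k` forces `x` to be supported at `i`: `x = e_i^{x_i}`. [cite: MochizukiFrdI2008, §0 p.12] -/
theorem eq_single_of_precsim_single {x : M} {i k : ℕ} (h : Precsim x (single i k)) :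
    x = single i (coeff x i) := by
  obtain ⟨n, -, hn⟩ := h
  rw [single_pow, eq_ofAdd x, single, ofAdd_dvd_iff] at hn
  change Multiplicative.ofAdd (Multiplicative.toAdd x) = Multiplicative.ofAdd _
  congr 1
  funext j
  by_cases hj : j = i
  · subst hj; simp
  · have := hn j
    simp [hj] at this
    simp [hj, this]

/-- `e_i^k ≼ e_i^l` for `l ≠ 0`. [cite: MochizukiFrdI2008, §0 p.12] -/
theorem single_precsim_single (i k : ℕ) {l : ℕ} (hl : l ≠ 0) : Precsim (single i k) (single i l) := by
  refine ⟨k + 1, Nat.succ_pos _, ?_⟩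
  rw [single_pow, single, single, ofAdd_dvd_iff]
  intro j
  by_cases hj : j = i
  · subst hj
    simp only [Pi.single_eq_same]
    calc k ≤ k + 1 := Nat.le_succ _
      _ = (k + 1) * 1 := (Nat.mul_one _).symm
      _ ≤ (k + 1) * l := Nat.mul_le_mul_left _ (Nat.one_le_iff_ne_zero.2 hl)
  · simp [hj]

/-- `x ≼ e_i^k` with `x ≠ 1` and `k ≠ 0` gives `e_i^k ≼ x`. [cite: MochizukiFrdI2008, §0 p.12] -/
theorem single_precsim_of_precsim_single {x : M} {i k : ℕ} (hx : x ≠ 1) (h : Precsim x (single i k)) :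
    Precsim (single i k) x := by
  have hxe := eq_single_of_precsim_single h
  have hc : coeff x i ≠ 0 := fun h0 => hx (by rw [hxe, h0, single_zero])
  rw [hxe]
  exact single_precsim_single i k hc

/-- **`e_i^k` (`k ≠ 0`) is a primary element of `M = (ℤ≥0)^ℕ`** (the primes of a product are its
coordinates). [cite: MochizukiFrdI2008, §0 p.12] -/
theorem isPrimary_single (i : ℕ) {k : ℕ} (hk : k ≠ 0) : IsPrimary (single i k) :=
  ⟨single_ne_one hk, fun _ hx h => single_precsim_of_precsim_single hx h⟩

/-- `e_i ≼ e_j` only if `i = j`. [cite: MochizukiFrdI2008, §0 p.12] -/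
theorem eq_of_single_precsim_single {i j : ℕ} (h : Precsim (single i 1) (single j 1)) : i = j := by
  have := congrFun (congrArg Multiplicative.toAdd (eq_single_of_precsim_single h)) i
  by_contra hij
  simp [single, coeff, hij] at this

/-- `M = (ℤ≥0)^ℕ` is sharp. [cite: MochizukiFrdI2008, §0 p.11] -/
theorem isSharp_M : IsSharp M := by
  refine ⟨fun x hx => ?_⟩
  obtain ⟨y, hy⟩ := hx.exists_right_inv
  have h : Multiplicative.toAdd x + Multiplicative.toAdd y = 0 := congrArg Multiplicative.toAdd hy
  have hx0 : Multiplicative.toAdd x = 0 := by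
    funext j
    have := congrFun h j
    simp only [Pi.add_apply, Pi.zero_apply] at this
    show Multiplicative.toAdd x j = 0
    omega
  calc x = Multiplicative.ofAdd (Multiplicative.toAdd x) := rfl
    _ = 1 := by rw [hx0]; rfl

/-! ### The primes `𝔮_i` of `M^pf` and the elements of `M^pf_{𝔮_i}` -/

/-- The prime `𝔮_i` of `M^pf`: the class of (the image of) `e_i`. [cite: MochizukiFrdI2008, §0 p.12] -/
def q (i : ℕ) : Primes (Perfection M) :=
  Quotient.mk (primarySetoid _)
    ⟨Perfection.of M (single i 1), (Perfection.isPrimary_of_iff isSharp_M).2 (isPrimary_single i one_ne_zero)⟩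

/-- `e_i ∈ 𝔮_i`. [cite: MochizukiFrdI2008, §0 p.12] -/
theorem of_single_mem_carrier (i : ℕ) : Perfection.of M (single i 1) ∈ (q i).carrier :=
  mem_carrier_mk_of_isPrimary _

/-- `i ↦ 𝔮_i` is injective. [cite: MochizukiFrdI2008, §0 p.12] -/
theorem q_injective : Injective q := by
  intro i j hij
  have h := Primes.precsim_of_mem_carrier (q i) (of_single_mem_carrier i) (hij ▸ of_single_mem_carrier j)
  exact eq_of_single_precsim_single (Perfection.of_precsim_of_iff.1 h)

/-- Every root `(e_i^m)^{1/k}` with `m ≠ 0` lies in `𝔮_i`. [cite: MochizukiFrdI2008, §0 p.12] -/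
theorem mk_single_mem_carrier (i : ℕ) {m : ℕ} (hm : m ≠ 0) (k : ℕ+) :
    Perfection.mk (single i m) k ∈ (q i).carrier := by
  have hprim : IsPrimary (Perfection.mk (single i m) k) :=
    (PerfectionPrimes.isPrimary_mk_iff isSharp_M _ _).2 (isPrimary_single i hm)
  refine Primes.mem_carrier_of_precsim (q i) (of_single_mem_carrier i) hprim.1 ?_
  -- `(e_i^m)^{1/k} ≼ e_i`: through `(e_i^m)^{1/k} ≼ e_i^m ≼ e_i`
  exact (Perfection.mk_precsim_of (single i m) k).1.trans
    (Perfection.of_precsim_of_iff.2 (single_precsim_single i m one_ne_zero))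

/-- Every root `(e_i^m)^{1/k}` lies in the submonoid `M^pf_{𝔮_i}`. [cite: MochizukiFrdI2008, §0 p.12] -/
theorem mk_single_mem_submonoid (i m : ℕ) (k : ℕ+) : Perfection.mk (single i m) k ∈ (q i).submonoid := by
  by_cases hm : m = 0
  · subst hm
    rw [single_zero, Perfection.mk_one]
    exact one_mem _
  · exact Submonoid.subset_closure (mk_single_mem_carrier i hm k)

/-- **The elements of `M^pf_{𝔮_i}` are the roots `(e_i^m)^{1/k}`.** [cite: MochizukiFrdI2008, §0 p.12] -/
theorem exists_eq_mk_single_of_mem_submonoid (i : ℕ) {x : Perfection M} (hx : x ∈ (q i).submonoid) :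
    ∃ (m : ℕ) (k : ℕ+), x = Perfection.mk (single i m) k := by
  induction hx using Submonoid.closure_induction with
  | mem y hy =>
    obtain ⟨⟨g, k⟩, rfl⟩ := Perfection.mk_surjective y
    -- `g^{1/k} ∼ e_i` gives `g ≼ e_i`, so `g` is supported at `i`
    have h1 := Primes.precsim_of_mem_carrier (q i) hy (of_single_mem_carrier i)
    have h2 : Precsim (Perfection.of M g) (Perfection.of M (single i 1)) :=
      (Perfection.mk_precsim_of g k).2.trans h1
    refine ⟨coeff g i, k, ?_⟩
    dsimp only
    rw [← eq_single_of_precsim_single (Perfection.of_precsim_of_iff.1 h2)]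
  | one => exact ⟨0, 1, by rw [single_zero, Perfection.mk_one]⟩
  | mul y z _ _ hy hz =>
    obtain ⟨m, k, rfl⟩ := hy
    obtain ⟨m', k', rfl⟩ := hz
    refine ⟨m * k' + m' * k, k * k', ?_⟩
    rw [Perfection.mk_mul_mk, single_pow, single_pow, single_mul_single]
    congr 2
    ring
/-! ### Divisibility of roots of coordinate vectors -/
/-- If `(e_i^m)^{1/k}` divides `f` in `M^pf`, then `m ≤ k · f_i`. [cite: MochizukiFrdI2008, §0 p.11] -/
theorem le_mul_coeff_of_mk_single_dvd_of {i m : ℕ} {k : ℕ+} {f : M}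
    (h : Perfection.mk (single i m) k ∣ Perfection.of M f) : m ≤ (k : ℕ) * coeff f i := by
  obtain ⟨w, hw⟩ := h
  obtain ⟨⟨g, l⟩, rfl⟩ := Perfection.mk_surjective w
  dsimp only at hw
  rw [Perfection.of_apply, Perfection.mk_mul_mk, Perfection.mk_eq_mk_iff] at hw
  obtain ⟨N, hN⟩ := hw
  -- compare the `i`-th exponents
  have h1 := congrArg (fun x : M => coeff x i) hN
  simp only [coeff_pow, coeff_mul, coeff_single_same, PNat.mul_coe, PNat.one_coe, mul_one] at h1
  -- h1 : N * (k * l) * f_i = N * (l * m + k * g_i)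
  have h2 : (l : ℕ) * m ≤ (l : ℕ) * ((k : ℕ) * coeff f i) := by
    have h3 : (k : ℕ) * (l : ℕ) * coeff f i = (l : ℕ) * m + (k : ℕ) * coeff g i := by
      apply Nat.eq_of_mul_eq_mul_left N.pos
      rw [← mul_assoc]
      exact h1
    calc (l : ℕ) * m ≤ (l : ℕ) * m + (k : ℕ) * coeff g i := Nat.le_add_right _ _
      _ = (l : ℕ) * ((k : ℕ) * coeff f i) := by rw [← h3]; ring
  exact Nat.le_of_mul_le_mul_left h2 l.pos

/-- Conversely, if `m ≤ k · f_i` then `(e_i^m)^{1/k}` divides `e_i^{f_i}` INSIDE `M^pf_{𝔮_i}`.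
[cite: MochizukiFrdI2008, §0 p.11] -/
theorem mk_single_dvd_of_single_coeff {i m : ℕ} {k : ℕ+} {f : M} (h : m ≤ (k : ℕ) * coeff f i)
    (hx : Perfection.mk (single i m) k ∈ (q i).submonoid) :
    (⟨Perfection.mk (single i m) k, hx⟩ : PfAt M (q i)) ∣
      ⟨Perfection.of M (single i (coeff f i)), mk_single_mem_submonoid i (coeff f i) 1⟩ := by
  refine ⟨⟨Perfection.mk (single i ((k : ℕ) * coeff f i - m)) k, mk_single_mem_submonoid i _ k⟩,
    Subtype.ext ?_⟩
  change Perfection.of M (single i (coeff f i)) =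
    Perfection.mk (single i m) k * Perfection.mk (single i ((k : ℕ) * coeff f i - m)) k
  rw [Perfection.mk_mul_mk, single_pow, single_pow, single_mul_single, Perfection.of_apply,
    Perfection.mk_eq_mk_iff]
  refine ⟨1, ?_⟩
  rw [single_pow, single_pow]
  congr 1
  simp only [PNat.mul_coe, PNat.one_coe, one_mul, mul_one]
  have hk : (k : ℕ) * m + (k : ℕ) * ((k : ℕ) * coeff f i - m) = (k : ℕ) * ((k : ℕ) * coeff f i) := by
    rw [← Nat.mul_add, Nat.add_sub_cancel' h]
  rw [hk, ← mul_assoc]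
/-! ### The factorization homomorphism at `𝔮_i`: the `i`-th coordinate -/
/-- The `𝔮_i`-component `e_i^{f_i} ⊗ 1` of (the image of) `f ∈ M`. [cite: MochizukiFrdI2008, Def. 2.4(i) p.47] -/
def coordAt (f : M) (i : ℕ) : PfAt M (q i) :=
  ⟨Perfection.of M (single i (coeff f i)), mk_single_mem_submonoid i (coeff f i) 1⟩

/-- **For perf-factorial `M` (hypothesis), the factorization of `f ∈ M` at `𝔮_i` is `e_i^{f_i} ⊗ 1`.**
[cite: MochizukiFrdI2008, Def. 2.4(i) p.47] -/
theorem factorMap_of_apply (h : IsPerfFactorial M) (f : M) (i : ℕ) :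
    factorMap M (Perfection.of M f) (q i) = Realification.of (PfAt M (q i)) (coordAt f i) := by
  apply Realification.dvd_antisymm
  · -- `≤`: every element of `Bound_{𝔮_i ∪ {0}}(f)` is below `e_i^{f_i} ⊗ 1`
    apply h.factorMap_dvd_of_isBoundedBy
    rintro _ ⟨x, hx, hxf, rfl⟩
    obtain ⟨m, k, hmk⟩ := exists_eq_mk_single_of_mem_submonoid i x.2
    have hle : m ≤ (k : ℕ) * coeff f i := le_mul_coeff_of_mk_single_dvd_of (hmk ▸ hxf)
    have hx' : x = ⟨Perfection.mk (single i m) k, hmk ▸ x.2⟩ := Subtype.ext hmk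
    rw [hx']
    exact map_dvd _ (mk_single_dvd_of_single_coeff hle _)
  · -- `≥`: `e_i^{f_i}` itself lies in `Bound_{𝔮_i ∪ {0}}(f)`
    refine h.of_dvd_factorMap (coordAt f i) ?_ ?_
    · by_cases hc : coeff f i = 0
      · right
        change Perfection.of M (single i (coeff f i)) = 1
        rw [hc, single_zero, map_one]
      · exact Or.inl (mk_single_mem_carrier i hc 1)
    · change Perfection.of M (single i (coeff f i)) ∣ Perfection.of M f
      refine map_dvd _ ?_
      rw [eq_ofAdd f, single, ofAdd_dvd_iff]
      intro j
      by_cases hj : j = i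
      · subst hj; simp [coeff]
      · simp [hj]

/-- Transport of membership along an equality of primes. [folklore] -/
private theorem mem_submonoid_of_eq {𝔮 : Primes (Perfection M)} {i : ℕ} (h : q i = 𝔮) {x : Perfection M}
    (hx : x ∈ (q i).submonoid) : x ∈ 𝔮.submonoid := h ▸ hx

/-! ### The counterexample -/

/-- **`(ℤ≥0)^ℕ` is not perf-factorial in the sense of [FrdI] Def. 2.4 (i) as printed: clause (d) fails.**
With `b = (1, 1, …)` and `a = (e_i^{1/(i+2)})_i ∈ ∏ M^pf_{𝔮_i}`, `Supp(a) ⊆ Supp(b)`, so (d) yields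
`a = ` the factorization of some `c = m^{1/n} ∈ M^pf`; at `𝔮_n` this reads `(n+2) · m_n = n`.
[cite: MochizukiFrdI2008, Def. 2.4(i) p.47] -/
theorem not_isPerfFactorial_multiplicative_pi_nat : ¬ IsPerfFactorial (Multiplicative (ℕ → ℕ)) := by
  intro h
  classical
  -- the roots `u_i := e_i^{1/(i+2)} ∈ M^pf_{𝔮_i}`
  let r : ℕ → ℕ+ := fun i => ⟨i + 2, Nat.succ_pos _⟩
  have hu : ∀ i, Perfection.mk (single i 1) (r i) ∈ (q i).submonoid := fun i => mk_single_mem_submonoid i 1 _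
  -- the element `a ∈ M^pf_factor`
  let a : PfFactor M := fun 𝔮 =>
    ⟨if hq : ∃ i, q i = 𝔮 then Perfection.mk (single hq.choose 1) (r hq.choose) else 1, by
      split_ifs with hq
      · exact mem_submonoid_of_eq hq.choose_spec (hu hq.choose)
      · exact one_mem _⟩
  have ha : ∀ i, a (q i) = ⟨Perfection.mk (single i 1) (r i), hu i⟩ := by
    intro i
    have hq : ∃ j, q j = q i := ⟨i, rfl⟩
    have hi : hq.choose = i := q_injective hq.choose_spec
    apply Subtype.ext
    change (if hq : ∃ j, q j = q i then Perfection.mk (single hq.choose 1) (r hq.choose) else 1) = _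
    rw [dif_pos hq, hi]
  -- `b = (1, 1, …)`
  let b : M := Multiplicative.ofAdd fun _ => 1
  have hsupp : supp (pfFactorToRlfFactor M a) ⊆ supp (factorMap M (Perfection.of M b)) := by
    intro 𝔮 h𝔮
    -- off the `𝔮_i` the component of `a` is `1`
    have hq : ∃ i, q i = 𝔮 := by
      by_contra hne
      apply h𝔮
      rw [pfFactorToRlfFactor_apply]
      have : a 𝔮 = 1 := Subtype.ext (by
        change (if hq : ∃ i, q i = 𝔮 then Perfection.mk (single hq.choose 1) (r hq.choose) else 1) = 1
        rw [dif_neg hne])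
      rw [this, map_one]
    obtain ⟨i, rfl⟩ := hq
    -- at `𝔮_i` the factorization of `b` is `e_i ⊗ 1 ≠ 1`
    change factorMap M (Perfection.of M b) (q i) ≠ 1
    rw [factorMap_of_apply h b i]
    intro h1
    have hinj := Realification.of_injective
      (isMonoprime_submonoid_primes_perfection h.isDivisorial.isSharp h.isMonoprime (q i))
    have h2 : coordAt b i = 1 := hinj (h1.trans (map_one _).symm)
    have h3 := congrArg (fun x : PfAt M (q i) => (x : Perfection M)) h2
    change Perfection.of M (single i (coeff b i)) = 1 at h3
    rw [Perfection.of_apply, Perfection.mk_eq_one_iff_of_isSharp isSharp_M] at h3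
    exact single_ne_one (by simp [coeff, b]) h3
  -- clause (d): `a` is the factorization of some `c = m^{1/n}`
  obtain ⟨c, hc⟩ := h.mem_range_of_supp_subset a (Perfection.of M b) hsupp
  obtain ⟨⟨m, n⟩, rfl⟩ := Perfection.mk_surjective c
  dsimp only at hc
  -- compare `𝔮_n`-components of the factorizations of `m = c^n`
  have hm : factorMap M (Perfection.of M m) = pfFactorToRlfFactor M a ^ (n : ℕ) := by
    rw [← Perfection.mk_pow_self m n, ← h.factorHom_apply, map_pow, h.factorHom_apply, hc]
  have hn := congrFun hm (q n)
  rw [factorMap_of_apply h m n, Pi.pow_apply, pfFactorToRlfFactor_apply, ← map_pow, ha n] at hn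
  have hinj := Realification.of_injective
    (isMonoprime_submonoid_primes_perfection h.isDivisorial.isSharp h.isMonoprime (q n))
  have h4 := congrArg (fun x : PfAt M (q n) => (x : Perfection M)) (hinj hn)
  change Perfection.of M (single n (coeff m n)) = Perfection.mk (single n 1) (r n) ^ (n : ℕ) at h4
  rw [Perfection.mk_pow, single_pow, Perfection.of_apply, Perfection.mk_eq_mk_iff] at h4
  obtain ⟨N, hN⟩ := h4
  have h5 := congrFun (congrArg Multiplicative.toAdd hN) n
  rw [single_pow, single_pow, single, single] at h5
  simp only [toAdd_ofAdd, Pi.single_eq_same, PNat.one_coe, mul_one] at h5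
  -- h5 : N * (n + 2) * m_n = N * n
  have hN0 : 0 < (N : ℕ) := N.pos
  have hn0 : 0 < (n : ℕ) := n.pos
  have h6 : ((n : ℕ) + 2) * coeff m n = (n : ℕ) := by
    apply Nat.eq_of_mul_eq_mul_left hN0
    have : (N : ℕ) * ((r n : ℕ+) : ℕ) * coeff m n = (N : ℕ) * (n : ℕ) := by
      simpa [mul_comm, mul_assoc, mul_left_comm] using h5
    simpa [r, mul_assoc] using this
  rcases Nat.eq_zero_or_pos (coeff m n) with h0 | hpos
  · rw [h0, mul_zero] at h6
    omega
  · nlinarith [h6, hpos]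

end PerfFactorialProductCounterexample

end Literature.AlgebraicGeometry.Frobenioids
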